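import Literature.NumberTheory.LFunctions.Zhang2022.Section12LogFreeCore
import Literature.NumberTheory.LFunctions.Zhang2022.Section12LogFreeWindow
import Literature.NumberTheory.LFunctions.Zhang2022.Section12LogFreeBookkeeping
import Literature.NumberTheory.LFunctions.Zhang2022.Section12Eq1211Reduction
import HarnessLib

/-!
# Zhang (2022) §12: the log-free twisted sum of the middle range HOLDS — the leaf
# `Typed.Sec12C.Mid1225` closed

Topic `Literature/NumberTheory/LFunctions/Zhang2022` (Landau–Siegel audit tree; verdict-neutral).
Y. Zhang, *Discrete mean estimates and the Landau–Siegel zero*, arXiv:2211.02515v1 (2022)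
[Zhang2022LandauSiegel] — **an unrefereed manuscript under adjudication; nothing here asserts or
denies its Theorems 1–2, and no claim about Landau–Siegel zeros is made.** Lane ZHANG-L (strike
seat zl-closer-3), leaf `Typed.Sec12C.Mid1225 c′` of `Skeleton.theorem1_of_leaves_v19` (§12 p.71,
tex L3605: "By lemma 8.2, 8.3 and 12.1, the sum over `P″₁/T < dr ≤ P″₁` contributes `o(α)`"; the
underlying (12.11) has no proof in print, tex L3549, GAP row G-L3t5-2).

`Lemma84.logfree_mid_bound` PROVES the log-free input LF of the tree's reduction
`Typed.Sec12C.mid1225_of_logfree` (zl-w12-p1), verbatim: for every `c′` there is `C` with, for all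
large `D` under (A), `j ∈ {1,2,3}`, `d, r ≥ 1`, `P″₁/T < dr ≤ P″₁`,
`‖Σ_{1≤l<P″₂/dr} χ(l)ξ₀ⱼ(l;d,r)l^{−(1−β₆)}‖ ≤ C𝓛⁻⁴(dr/φ(dr))⁴`. Route: with `Y = P″₂/dr`
(`P^{0.004} ≤ Y ≤ P`), `Y′ = Ye^{−h}`, `h = 𝓛⁻⁵⁰`, the sharp sum is
`(R(Y) − R(Y′))/h + O(Σ_{Y′<n≤Y}|ξ₀ⱼ(n)|/n)` (`Lemma84.norm_sum_Ico_le_of_riesz`); the difference of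
the two logarithmic Riesz means is bounded on Landau's contour by `Lemma84.logfree_core` (the
Lemma-8.4 engine of the tree with the small rectangle estimated directly — no residue), fed with the
relative Lemma 8.3 (`Skeleton.lemma83Rel_holds`), the exceptional-zero package, Lemma 5.7 and 5.8
exactly as in `Lemma84.lemma84Rel_of_lemma83Rel`; `Lemma84.rhs_logfree_le` does the bookkeeping
(`𝓛⁻⁷Π̂²` from the small rectangle, exponentially small elsewhere) and `Lemma84.window_xiZero_le`
(Shiu) bounds the window by `𝓛⁻¹⁴`. Hence `Typed.Sec12C.mid1225_holds : 0 ≤ c′ → Mid1225 c′` —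
**the leaf, unconditionally** (for the manuscript's parameter range `c′ ≥ 0`).

Theorems only; no new definitions, no facts; standard axioms.

## References

* Y. Zhang, arXiv:2211.02515v1 (2022), §12 p.71 (before (12.12)), Lemma 12.2 (12.11) p.70; §8
  Lemmas 8.3–8.4; §5 Lemmas 5.5, 5.7, 5.8. [cite: Zhang2022LandauSiegel, §12 (12.12) p.71; (12.11) p.70]
* H. L. Montgomery, R. C. Vaughan, *Multiplicative Number Theory I*, CUP 2007, §6.2, Thm 11.4.
  [cite: MontgomeryVaughan2007, Thm 11.4]
* P. Shiu, J. reine angew. Math. 313 (1980), 161–170, Theorem 1. [cite: Shiu1980, Theorem 1]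
-/

noncomputable section

open Complex Real Finset

namespace Literature.NumberTheory.LFunctions.Zhang2022.Lemma84

open Skeleton XiZeroMajorant

/-- A threshold `D₁` beyond which `log D ≥ M`. [folklore] -/
private theorem exists_nat_le_log' (M : ℝ) : ∃ D₀ : ℕ, ∀ D : ℕ, D₀ ≤ D → M ≤ Real.log D := by
  refine ⟨⌈Real.exp M⌉₊ + 1, fun D hD => ?_⟩
  have h1 : Real.exp M ≤ D := by
    have : (⌈Real.exp M⌉₊ : ℝ) + 1 ≤ D := by exact_mod_cast hD
    linarith [Nat.le_ceil (Real.exp M)]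
  have hD0 : (0 : ℝ) < D := lt_of_lt_of_le (Real.exp_pos M) h1
  rw [Real.le_log_iff_exp_le hD0]
  exact h1

/-- `∏_{q∣n}(1 − q⁻¹)⁻¹ = n/φ(n)` for `n ≥ 1`. [folklore] -/
private theorem prodInv_eq_self_div_totient {n : ℕ} (hn : n ≠ 0) :
    ∏ q ∈ n.primeFactors, (1 - (q : ℝ)⁻¹)⁻¹ = (n : ℝ) / Nat.totient n := by
  rw [self_div_totient_eq_prod hn]
  refine Finset.prod_congr rfl fun q hq => ?_
  have hq : (1 : ℝ) < q := by exact_mod_cast (Nat.prime_of_mem_primeFactors hq).one_lt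
  have hq0 : (q : ℝ) ≠ 0 := by linarith
  have hq1 : (q : ℝ) - 1 ≠ 0 := by linarith
  field_simp

set_option maxHeartbeats 1600000 in
/-- **The log-free twisted sum of the middle range** (= the hypothesis LF of
`Typed.Sec12C.mid1225_of_logfree`, verbatim): for every `c′` there is `C` such that for all large `D`
under (A), `j ∈ {1,2,3}`, `d, r ≥ 1` with `P″₁/T < dr ≤ P″₁`:
`‖Σ_{1≤l<P″₂/dr} χ(l)ξ₀ⱼ(l;d,r)l^{−(1−β₆)}‖ ≤ C·𝓛⁻⁴·(dr/φ(dr))⁴`.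
[cite: Zhang2022LandauSiegel, §12 Lemma 12.2 (12.11) p.70; §8 Lemma 8.4 (proof) p.47]
[cite: MontgomeryVaughan2007, §6.2, Thm 11.4] -/
theorem logfree_mid_bound (c' : ℝ) :
    ∃ C : ℝ, ForAllLarge fun D _ χ => AssumptionA D χ →
      ∀ j ∈ ({1, 2, 3} : Finset ℕ), ∀ d r : ℕ, 1 ≤ d → 1 ≤ r →
        P1pp D / bigT D < ((d * r : ℕ) : ℝ) → ((d * r : ℕ) : ℝ) ≤ P1pp D →
          ‖∑ l ∈ Finset.Ico 1 ⌈P2pp D / ((d * r : ℕ) : ℝ)⌉₊,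
              χ (l : ZMod D) * xiZero c' D j l d r / (l : ℂ) ^ (1 - beta6 D)‖ ≤
            C * (ell D ^ 4)⁻¹ * ((((d * r : ℕ) : ℝ)) / Nat.totient (d * r)) ^ 4 := by
  obtain ⟨C₈₃, D83, h83⟩ := lemma83Rel_holds c'
  obtain ⟨c, hc, hc4, Cinv, hCinv, K, hK, D₁, hpack⟩ := exceptional_package
  obtain ⟨L₅₇, h57⟩ := Lemma57.lemma_5_7
  obtain ⟨Cw, x₀, hCw0, hx₀, hwin⟩ := window_xiZero_le
  -- constants
  set C : ℝ := |C₈₃| with hCdef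
  have hC0 : 0 ≤ C := abs_nonneg _
  set K₈ : ℝ := 7 + 15 * |c'| with hK₈
  have hK₈1 : 1 ≤ K₈ := by rw [hK₈]; linarith [abs_nonneg c']
  set C₅ : ℝ := 1 + 16 * Real.exp (9 / 2) * π ^ 2 * K₈ ^ 2 with hC₅
  set ℓ₀ : ℝ := Real.exp (-1) / 4 with hℓ₀
  have hℓ₀0 : 0 < ℓ₀ := by positivity
  set m : ℕ := ⌈2 * C⌉₊ with hm
  set A₁ : ℝ := C * (Real.exp (8 * C + 4 * C * ((Nat.factorial 9 : ℝ) / 2 ^ 9)) * 2 ^ m) with hA₁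
  have hA₁0 : 0 ≤ A₁ := by positivity
  set Cbook : ℝ := 1 / (2 * π) * (4 * Real.exp π * A₁ * (m + 81).factorial +
      81600 * π * Real.exp (1 / 96) * A₁ * Cinv / c ^ 2 *
        ((m + 59).factorial / (c / 2000) ^ (m + 59)) +
      3600 * Real.exp π * A₁ * Cinv * ((m + 57).factorial / 2 ^ (m + 57)) +
      672 * Real.exp π * ((1 + 16 * Real.exp (9 / 2) * π ^ 2 * K₈ ^ 2) * (24 * K₈ ^ 2 + 2 * K₈) +
        128 * π * Real.exp (9 / 2) * K₈ ^ 3 * C + 8 * π * Real.exp (9 / 2) * K₈ ^ 2))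
    with hCbook
  -- the threshold
  set Lmax : ℝ := max (max (max 4 L₅₇) (max (8 * π / c) (16 * K / c)))
    (max (max (K + 1) (K₈ * π)) (max (4 * C₅ / (ℓ₀ * π)) x₀)) with hLmax
  obtain ⟨D₂, hD₂⟩ := exists_nat_le_log' Lmax
  refine ⟨Cbook + 4 * Cw, max (max D83 D₁) D₂,
    fun D _ χ hD hq hp hA j hj d r hd hr hlo hhi => ?_⟩
  have hD83 : D83 ≤ D := le_trans (le_trans (le_max_left _ _) (le_max_left _ _)) hD
  have hD₁ : D₁ ≤ D := le_trans (le_trans (le_max_right _ _) (le_max_left _ _)) hD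
  have hLm : Lmax ≤ Real.log D := hD₂ D (le_trans (le_max_right _ _) hD)
  set 𝓛 : ℝ := Real.log D with h𝓛def
  have h𝓛4 : 4 ≤ 𝓛 := le_trans (by simp [hLmax]) hLm
  have h𝓛3 : 3 ≤ 𝓛 := by linarith
  have hL57 : L₅₇ ≤ 𝓛 := le_trans (by simp [hLmax]) hLm
  have hL8πc : 8 * π / c ≤ 𝓛 := le_trans (by simp [hLmax]) hLm
  have hL16K : 16 * K / c ≤ 𝓛 := le_trans (by simp [hLmax]) hLm
  have hLK1 : K + 1 ≤ 𝓛 := le_trans (by simp [hLmax]) hLm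
  have hLK₈ : K₈ * π ≤ 𝓛 := le_trans (by simp [hLmax]) hLm
  have hLC₅ : 4 * C₅ / (ℓ₀ * π) ≤ 𝓛 := le_trans (by simp [hLmax]) hLm
  have hLx₀ : x₀ ≤ 𝓛 := le_trans (by simp [hLmax]) hLm
  have h𝓛0 : 0 < 𝓛 := by linarith
  have h𝓛1 : 1 ≤ 𝓛 := by linarith
  have hℓ : ell D = 𝓛 := rfl
  have hπ0 := Real.pi_pos
  have hπ3 := Real.pi_gt_three
  -- `D` itself
  have hD0 : (0 : ℝ) < D := by
    rcases lt_or_ge 0 (D : ℝ) with h | h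
    · exact h
    · have : Real.log (D : ℝ) ≤ 0 := by
        have : (D : ℝ) = 0 := le_antisymm h (Nat.cast_nonneg D)
        rw [this, Real.log_zero]
      linarith
  have hDexp : (D : ℝ) = Real.exp 𝓛 := by rw [h𝓛def, Real.exp_log hD0]
  have hD3 : (3 : ℝ) ≤ D := by
    have : Real.exp 3 ≤ Real.exp 𝓛 := Real.exp_le_exp.2 h𝓛3
    have h3 : (3 : ℝ) ≤ Real.exp 3 := by have := Real.add_one_le_exp (3 : ℝ); linarith
    linarith
  have hD2 : 2 ≤ D := by exact_mod_cast (show (2 : ℝ) ≤ D by linarith)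
  have hχ1 : χ ≠ 1 := Lemma31.ne_one_of_isPrimitive χ hD2 hp
  have hA' : ‖χ.LFunction 1‖ ≤ 1 / Real.log D ^ 2022 := le_of_lt hA
  have hA'' : ‖χ.LFunction 1‖ < (Real.log D ^ 2022)⁻¹ := by rw [← one_div]; exact hA
  -- parameters
  set α : ℝ := alpha D with hαdef
  have hαeq : α = π / 𝓛 ^ 9 := alpha_eq D
  have hα0 : 0 < α := by rw [hαeq]; positivity
  set η : ℝ := c / (8 * 𝓛) with hηdef
  have hη0 : 0 < η := by positivity
  have hη' : η ≤ 1 / 96 := by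
    calc η = c / (8 * 𝓛) := hηdef
      _ ≤ (1 / 4) / (8 * 3) := by gcongr
      _ = 1 / 96 := by norm_num
  have hαη : α ≤ η := by
    rw [hαeq, hηdef, div_le_div_iff₀ (by positivity) (by positivity)]
    have h8 : 𝓛 ≤ 𝓛 ^ 8 := le_self_pow₀ h𝓛1 (by norm_num)
    have h1 : 8 * π ≤ c * 𝓛 := by rw [div_le_iff₀ hc] at hL8πc; linarith
    calc π * (8 * 𝓛) = (8 * π) * 𝓛 := by ring
      _ ≤ (c * 𝓛) * 𝓛 ^ 8 := by gcongr
      _ = c * 𝓛 ^ 9 := by ring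
  have hη40 : η ≤ 1 / 40 := by linarith
  -- the exceptional zero and the zero-free package
  obtain ⟨ρ, hρ1, hρK, hLρ, hL'ρ, hzfp⟩ := hpack D χ hD₁ hχ1 hA''
  have hρη : 1 - η / 2 ≤ ρ := by
    have h0 : 1 - ρ ≤ K / 𝓛 ^ 2 := by
      refine hρK.trans ?_
      rw [← div_eq_mul_inv]
      exact div_le_div_of_nonneg_left hK.le (by positivity) (pow_le_pow_right₀ h𝓛1 (by norm_num))
    have h1 : K / 𝓛 ^ 2 ≤ c / (16 * 𝓛) := by
      rw [div_le_div_iff₀ (by positivity) (by positivity)]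
      have h16 : 16 * K ≤ c * 𝓛 := by rw [div_le_iff₀ hc] at hL16K; linarith
      calc K * (16 * 𝓛) = (16 * K) * 𝓛 := by ring
        _ ≤ (c * 𝓛) * 𝓛 := by gcongr
        _ = c * 𝓛 ^ 2 := by ring
    rw [hηdef]
    have : c / (8 * 𝓛) / 2 = c / (16 * 𝓛) := by ring
    linarith
  have hρα : 1 - α / 2 < ρ := by
    have h1 : 1 - ρ ≤ K / 𝓛 ^ 10 := by
      refine hρK.trans ?_
      rw [← div_eq_mul_inv]
      exact div_le_div_of_nonneg_left hK.le (by positivity) (pow_le_pow_right₀ h𝓛1 (by norm_num))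
    have h2 : K / 𝓛 ^ 10 < π / 𝓛 ^ 9 / 2 := by
      rw [div_div, div_lt_div_iff₀ (by positivity) (by positivity)]
      have h3 : K * 2 < π * 𝓛 := by
        calc K * 2 < 3 * (K + 1) := by linarith
          _ ≤ π * 𝓛 := mul_le_mul hπ3.le hLK1 (by linarith) (by linarith)
      calc K * (𝓛 ^ 9 * 2) = (K * 2) * 𝓛 ^ 9 := by ring
        _ < (π * 𝓛) * 𝓛 ^ 9 := by gcongr
        _ = π * 𝓛 ^ 10 := by ring
    rw [hαeq]; linarith
  -- the `1/L` package on `Re s ≥ 1 − 2η`, `|Im s| ≤ D + 1`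
  have hlog5 : Real.log ((D : ℝ) + 5) ≤ 2 * 𝓛 := by
    have h1 : (D : ℝ) + 5 ≤ (D : ℝ) ^ 2 := by
      have h0 : (0 : ℝ) ≤ ((D : ℝ) - 3) * ((D : ℝ) + 2) := mul_nonneg (by linarith) (by linarith)
      have e : ((D : ℝ) - 3) * ((D : ℝ) + 2) = (D : ℝ) ^ 2 - (D : ℝ) - 6 := by ring
      rw [e] at h0; linarith
    calc Real.log ((D : ℝ) + 5) ≤ Real.log ((D : ℝ) ^ 2) := Real.log_le_log (by positivity) h1
      _ = 2 * 𝓛 := by rw [Real.log_pow, h𝓛def]; ring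
  have hpk : ∀ s : ℂ, 1 - 2 * η ≤ s.re → |s.im| ≤ (D : ℝ) + 1 → s ≠ (ρ : ℂ) →
      χ.LFunction s ≠ 0 ∧ ‖(χ.LFunction s)⁻¹‖ ≤ 3 * Cinv * 𝓛 * (1 + ‖s - ρ‖⁻¹) := by
    intro s hs him hne
    have hls : Real.log (|s.im| + 4) ≤ 2 * 𝓛 :=
      (Real.log_le_log (by positivity) (by linarith)).trans hlog5
    have hl0 : 0 ≤ Real.log (|s.im| + 4) := Real.log_nonneg (by linarith [abs_nonneg s.im])
    have hsum0 : 0 < Real.log D + Real.log (|s.im| + 4) := by rw [← h𝓛def]; linarith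
    have hre : 1 - c / (Real.log D + Real.log (|s.im| + 4)) ≤ s.re := by
      have h1 : 2 * η ≤ c / (Real.log D + Real.log (|s.im| + 4)) := by
        rw [hηdef, le_div_iff₀ hsum0, ← h𝓛def]
        have : 2 * (c / (8 * 𝓛)) * (𝓛 + Real.log (|s.im| + 4)) ≤ 2 * (c / (8 * 𝓛)) * (3 * 𝓛) := by
          gcongr; linarith
        have e : 2 * (c / (8 * 𝓛)) * (3 * 𝓛) = 3 * c / 4 := by field_simp; ring
        linarith
      linarith
    obtain ⟨hne0, hb⟩ := hzfp s hre hne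
    refine ⟨hne0, hb.trans ?_⟩
    have : Cinv * (Real.log D + Real.log (|s.im| + 4)) ≤ 3 * Cinv * 𝓛 := by
      rw [← h𝓛def]
      calc Cinv * (𝓛 + Real.log (|s.im| + 4)) ≤ Cinv * (𝓛 + 2 * 𝓛) := by gcongr
        _ = 3 * Cinv * 𝓛 := by ring
    exact mul_le_mul_of_nonneg_right this (by positivity)
  -- the continuation `U` of Lemma 8.3 (relative form)
  have hd0 : d ≠ 0 := by omega
  have hr0 : r ≠ 0 := by omega
  have hdr0 : d * r ≠ 0 := mul_ne_zero hd0 hr0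
  have hdrpos : (0 : ℝ) < ((d * r : ℕ) : ℝ) := by exact_mod_cast Nat.pos_of_ne_zero hdr0
  -- sizes: `P″₁, P″₂, P, T`
  have hT1 : 1 < bigT D := by rw [bigT]; exact Real.one_lt_exp_iff.2 (by positivity)
  have hT2 : 1 ≤ bigT D ^ 2 := one_le_pow₀ hT1.le
  have hP1pp : 0 < P1pp D := Sec12D.P1pp_pos (by rw [← h𝓛def]; exact h𝓛1)
  have hP2pp : 0 < P2pp D := Sec12D.P2pp_pos (by rw [← h𝓛def]; exact h𝓛1)
  have hbigP1 : 1 < bigP D := by rw [bigP]; exact Real.one_lt_exp_iff.2 (by positivity)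
  have hP12 : P1pp D < P2pp D := by
    have e := Sec12D.P2pp_div_P1pp (D := D) (by rw [← h𝓛def]; exact h𝓛1)
    have hgt : 1 < bigP D ^ (0.004 : ℝ) := Real.one_lt_rpow hbigP1 (by norm_num)
    rw [← e, lt_div_iff₀ hP1pp] at hgt
    linarith
  have hP2le : P2pp D ≤ bigP D / bigT D ^ 2 :=
    Sec12D.P2pp_le_P_div_T_sq (by rw [← h𝓛def]; exact h𝓛3)
  have hdrP : ((d * r : ℕ) : ℝ) < bigP D / bigT D ^ 2 :=
    lt_of_le_of_lt hhi (lt_of_lt_of_le hP12 hP2le)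
  obtain ⟨U, hUd, hU1, hU2, hU3⟩ := h83 D χ hD83 hq hp hA j hj d r hd hr hdrP
  -- `U` on `Re w ≥ 1 − η`
  set MU : ℝ := C * Real.exp (2 * C * (Real.log (2 * Real.log D) + 4) +
    4 * C * Real.log D ^ 9 / (D : ℝ) ^ 2) with hMUdef
  have hMU0 : 0 ≤ MU := by positivity
  have hlogdr : Real.log ((d * r : ℕ) : ℝ) ≤ Real.log D ^ 9 := by
    have h1 : ((d * r : ℕ) : ℝ) ≤ bigP D := hdrP.le.trans (div_le_self (bigP_pos D).le hT2)
    calc Real.log ((d * r : ℕ) : ℝ) ≤ Real.log (bigP D) := Real.log_le_log hdrpos h1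
      _ = Real.log D ^ 9 := by rw [bigP, Real.log_exp, ell]
  have hU : ∀ w : ℂ, 1 - η ≤ w.re → ‖U w‖ ≤ MU := by
    intro w hw
    have hw9 : 9 / 10 < w.re := by linarith
    have h1 := hU2 w hw9
    have hηL : 2 * η * Real.log D ≤ 1 / 4 := by
      have e : 2 * (c / (8 * 𝓛)) * 𝓛 = c / 4 := by field_simp; ring
      rw [hηdef, ← h𝓛def, e]
      linarith
    have hprod := prod_primeFactors_le (D := D) (n := d * r) (by rw [← h𝓛def]; linarith) hdr0 hlogdr
      hC0 hη0.le hηL (σ := w.re) hw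
    calc ‖U w‖ ≤ C₈₃ * ∏ q ∈ (d * r).primeFactors, (1 + C₈₃ * (q : ℝ) ^ (-w.re)) := h1
      _ ≤ |C₈₃ * ∏ q ∈ (d * r).primeFactors, (1 + C₈₃ * (q : ℝ) ^ (-w.re))| := le_abs_self _
      _ = C * ∏ q ∈ (d * r).primeFactors, |1 + C₈₃ * (q : ℝ) ^ (-w.re)| := by
          rw [abs_mul, Finset.abs_prod]
      _ ≤ C * ∏ q ∈ (d * r).primeFactors, (1 + C * (q : ℝ) ^ (-w.re)) := by
          refine mul_le_mul_of_nonneg_left ?_ hC0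
          refine Finset.prod_le_prod (fun _ _ => abs_nonneg _) fun q _ => ?_
          calc |1 + C₈₃ * (q : ℝ) ^ (-w.re)| ≤ |(1 : ℝ)| + |C₈₃ * (q : ℝ) ^ (-w.re)| := abs_add_le _ _
            _ = 1 + C * (q : ℝ) ^ (-w.re) := by
                rw [abs_one, abs_mul, abs_of_nonneg (Real.rpow_nonneg (Nat.cast_nonneg q) _)]
      _ ≤ MU := mul_le_mul_of_nonneg_left hprod hC0
  have hMUle : MU ≤ A₁ * 𝓛 ^ m := by
    have h := frakM_le (D := D) hC0 (by rw [← h𝓛def]; exact h𝓛1)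
    rw [hMUdef, hA₁, h𝓛def]
    calc C * Real.exp (2 * C * (Real.log (2 * Real.log D) + 4) + 4 * C * Real.log D ^ 9 / (D : ℝ) ^ 2)
        ≤ C * (Real.exp (8 * C + 4 * C * ((Nat.factorial 9 : ℝ) / 2 ^ 9)) * 2 ^ ⌈2 * C⌉₊ *
            Real.log D ^ ⌈2 * C⌉₊) := mul_le_mul_of_nonneg_left h hC0
      _ = _ := by rw [hm]; ring
  have hU3' : ∀ s : ℂ, ‖s - 1‖ ≤ 5 * alpha D → ‖U s - PiW χ d r‖ ≤
      C * (ell D ^ 8)⁻¹ * ∏ q ∈ (d * r).primeFactors, (1 - (q : ℝ)⁻¹)⁻¹ := by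
    intro s hs
    refine (hU3 s hs).trans ?_
    have := Literature.NumberTheory.Sieve.GreenTao2008.GYCorr.one_le_prod_one_sub_inv_inv (d * r)
    gcongr
    exact le_abs_self _
  -- `L(s,χ)` on `Re s ≥ 1 − η`, `|s| ≤ D + 4`
  have hBL : ∀ s : ℂ, 1 - η ≤ s.re → ‖s‖ ≤ (D : ℝ) + 4 → ‖χ.LFunction s‖ ≤ 2 * (4 + 3 * 𝓛) := by
    intro s hs hsn
    have hls : Real.log (‖s‖ + 1) ≤ 2 * 𝓛 :=
      (Real.log_le_log (by positivity) (by linarith)).trans hlog5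
    have hl0 : 0 ≤ Real.log (‖s‖ + 1) := Real.log_nonneg (by linarith [norm_nonneg s])
    have h := norm_LFunction_le_near_one χ hχ1 (η := η) (by linarith) hs (by
      rw [← h𝓛def]
      calc η * (𝓛 + Real.log (‖s‖ + 1)) ≤ η * (𝓛 + 2 * 𝓛) := by gcongr
        _ = 3 * c / 8 := by rw [hηdef]; field_simp; ring
        _ ≤ 1 / 8 := by linarith)
    rw [← h𝓛def] at h
    linarith
  -- `|L′(1,χ)| ≥ ℓ₀`
  have hℓ' : ℓ₀ ≤ ‖deriv χ.LFunction 1‖ := by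
    have h := h57 D χ hp hq.sq_eq_one hL57 hA'
    have hφpos : (0 : ℝ) < Nat.totient D := by exact_mod_cast Nat.totient_pos.mpr (by omega)
    have hφle : (Nat.totient D : ℝ) ≤ D := by exact_mod_cast Nat.totient_le D
    have hrat : (1 : ℝ) ≤ (D : ℝ) / Nat.totient D := by rw [le_div_iff₀ hφpos]; linarith
    calc ℓ₀ = Real.exp (-1) / 4 * 1 := (mul_one _).symm
      _ ≤ Real.exp (-1) / 4 * ((D : ℝ) / Nat.totient D) := by gcongr
      _ ≤ (deriv χ.LFunction 1).re := h
      _ ≤ ‖deriv χ.LFunction 1‖ := Complex.re_le_norm _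
  -- Lemma 5.8's range and the `E ≤ ℓ₀α/4` condition
  have hK₈L : K₈ * π ≤ Real.log D ^ 8 := hLK₈.trans (le_self_pow₀ h𝓛1 (by norm_num))
  have hE : C₅ / Real.log D ^ 15 ≤ ℓ₀ * alpha D / 4 := by
    rw [← hαdef, hαeq, ← h𝓛def]
    rw [div_le_iff₀ (by positivity)]
    have h1 : 4 * C₅ ≤ ℓ₀ * π * 𝓛 := by rw [div_le_iff₀ (by positivity)] at hLC₅; linarith
    have h2 : 𝓛 ^ 15 = 𝓛 ^ 9 * 𝓛 ^ 6 := by ring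
    have h3 : 𝓛 ≤ 𝓛 ^ 6 := le_self_pow₀ h𝓛1 (by norm_num)
    have h4 : ℓ₀ * π * 𝓛 ≤ ℓ₀ * π * 𝓛 ^ 6 := mul_le_mul_of_nonneg_left h3 (by positivity)
    calc C₅ = 4 * C₅ / 4 := by ring
      _ ≤ ℓ₀ * π * 𝓛 ^ 6 / 4 := by linarith
      _ = ℓ₀ * (π / 𝓛 ^ 9) / 4 * 𝓛 ^ 15 := by rw [h2]; field_simp
  -- the two points `Y = P″₂/dr`, `Y′ = Ye^{−h}`, `h = 𝓛⁻⁵⁰`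
  set Y : ℝ := P2pp D / ((d * r : ℕ) : ℝ) with hYdef
  have hY0 : 0 < Y := div_pos hP2pp hdrpos
  set h : ℝ := (𝓛 ^ 50)⁻¹ with hhdef
  have h50 : (2 : ℝ) ≤ 𝓛 ^ 50 := le_trans (by linarith) (le_self_pow₀ h𝓛1 (by norm_num))
  have hh0 : 0 < h := by rw [hhdef]; positivity
  have hh12 : h ≤ 1 / 2 := by
    rw [hhdef, inv_eq_one_div]
    exact div_le_div_of_nonneg_left zero_le_one (by norm_num) h50
  set Y' : ℝ := Y * Real.exp (-h) with hY'def
  have hY'0 : 0 < Y' := mul_pos hY0 (Real.exp_pos _)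
  have hlogY' : Real.log Y' = Real.log Y - h := by
    rw [hY'def, Real.log_mul hY0.ne' (Real.exp_pos _).ne', Real.log_exp]; ring
  have hY'Y : Y' < Y := by
    rw [hY'def]
    exact mul_lt_of_lt_one_right hY0 (Real.exp_lt_one_iff.2 (by linarith))
  have hYeq : Y = Y' * Real.exp h := by
    rw [hY'def, mul_assoc, ← Real.exp_add, neg_add_cancel, Real.exp_zero, mul_one]
  -- `log Y ∈ [0.004𝓛⁹, 𝓛⁹]`
  have hYlo : bigP D ^ (0.004 : ℝ) ≤ Y := by
    rw [← Sec12D.P2pp_div_P1pp (D := D) (by rw [← h𝓛def]; exact h𝓛1), hYdef]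
    exact div_le_div_of_nonneg_left hP2pp.le hdrpos hhi
  have hlogY1 : 0.004 * 𝓛 ^ 9 ≤ Real.log Y := by
    have e : Real.log (bigP D ^ (0.004 : ℝ)) = 0.004 * 𝓛 ^ 9 := by
      rw [Real.log_rpow (bigP_pos D), bigP, Real.log_exp, hℓ]
    rw [← e]
    exact Real.log_le_log (Real.rpow_pos_of_pos (bigP_pos D) _) hYlo
  have hYle : Y ≤ bigP D := by
    have h1 : Y ≤ P2pp D := by
      rw [hYdef]
      exact div_le_self hP2pp.le (by exact_mod_cast Nat.one_le_iff_ne_zero.2 hdr0)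
    exact h1.trans (hP2le.trans (div_le_self (bigP_pos D).le hT2))
  have hlogY2 : Real.log Y ≤ 𝓛 ^ 9 := by
    calc Real.log Y ≤ Real.log (bigP D) := Real.log_le_log hY0 hYle
      _ = 𝓛 ^ 9 := by rw [bigP, Real.log_exp, hℓ]
  have hlogY0 : 0 ≤ Real.log Y := le_trans (by positivity) hlogY1
  have hlogY'1 : 0.004 * 𝓛 ^ 9 - 1 ≤ Real.log Y' := by rw [hlogY']; linarith
  have h47 : (4 : ℝ) ^ 7 ≤ 𝓛 ^ 7 := pow_le_pow_left₀ (by norm_num) h𝓛4 7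
  have hsq : 0 ≤ 𝓛 ^ 2 := sq_nonneg 𝓛
  have hbig : 𝓛 ^ 2 + 200 * 𝓛 + 1 ≤ 0.004 * 𝓛 ^ 9 := by
    have e : 𝓛 ^ 9 = 𝓛 ^ 7 * 𝓛 ^ 2 := by ring
    rw [e]
    have h1 : (4 : ℝ) ^ 7 * 𝓛 ^ 2 ≤ 𝓛 ^ 7 * 𝓛 ^ 2 := mul_le_mul_of_nonneg_right h47 hsq
    have hs : 4 * 𝓛 ≤ 𝓛 ^ 2 := by nlinarith [mul_nonneg (sub_nonneg.2 h𝓛4) h𝓛0.le]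
    norm_num at h1
    linarith
  have hlogY'2 : 𝓛 ^ 2 + 200 * 𝓛 ≤ Real.log Y' := by linarith
  have hlogY'0 : 0 ≤ Real.log Y' := by linarith
  have hlogY'le : Real.log Y' ≤ 𝓛 ^ 9 := by rw [hlogY']; linarith
  have hY'exp : Real.exp (200 * 𝓛) ≤ Y' := by
    rw [← Real.exp_log hY'0]; exact Real.exp_le_exp.2 (by linarith)
  have hexp𝓛 : 𝓛 ≤ Real.exp 𝓛 := by linarith [Real.add_one_le_exp 𝓛]
  have hY'1 : 1 ≤ Y' := le_trans (Real.one_le_exp (by positivity)) hY'exp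
  have hTY' : bigT D < Y' := by
    rw [bigT, hℓ]
    have h11 : 𝓛 ^ (1.1 : ℝ) ≤ 𝓛 ^ 2 := by
      have := Real.rpow_le_rpow_of_exponent_le h𝓛1 (show (1.1 : ℝ) ≤ 2 by norm_num)
      simpa using this
    calc Real.exp (𝓛 ^ (1.1 : ℝ)) ≤ Real.exp (𝓛 ^ 2) := Real.exp_le_exp.2 h11
      _ < Real.exp (Real.log Y') := Real.exp_lt_exp.2 (by linarith)
      _ = Y' := Real.exp_log hY'0
  have hx₀Y' : x₀ ≤ Y' := by
    calc x₀ ≤ 𝓛 := hLx₀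
      _ ≤ Real.exp 𝓛 := hexp𝓛
      _ ≤ Real.exp (200 * 𝓛) := Real.exp_le_exp.2 (by linarith)
      _ ≤ Y' := hY'exp
  have hlog1 : Real.log Y - Real.log Y' ≤ 1 := by rw [hlogY']; linarith
  have hlogh : Real.log Y - Real.log Y' = (𝓛 ^ 50)⁻¹ := by rw [hlogY', hhdef]; ring
  -- the window geometry: `Y ≤ 2Y′`, `Y′ + Y′^{1/4} ≤ Y`
  have hY2 : Y ≤ 2 * Y' := by
    rw [hYeq, mul_comm]
    refine mul_le_mul_of_nonneg_right ?_ hY'0.le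
    have hlog2 := Real.log_two_gt_d9
    calc Real.exp h ≤ Real.exp (Real.log 2) := Real.exp_le_exp.2 (by linarith)
      _ = 2 := Real.exp_log (by norm_num)
  have hYY'4 : Y' + Y' ^ (1 / 4 : ℝ) ≤ Y := by
    set u : ℝ := Y' ^ (1 / 4 : ℝ) with hudef
    have hu0 : 0 < u := Real.rpow_pos_of_pos hY'0 _
    have hu4 : u ^ 4 = Y' := by
      rw [hudef, ← Real.rpow_natCast, ← Real.rpow_mul hY'0.le]; norm_num
    have hu1 : 1 ≤ u := Real.one_le_rpow hY'1 (by norm_num)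
    have hubig : 𝓛 ^ 50 ≤ u := by
      have h1 : u = Real.exp (Real.log Y' * (1 / 4)) := by
        rw [hudef, Real.rpow_def_of_pos hY'0]
      have h2 : 𝓛 ^ 50 ≤ Real.exp 𝓛 ^ 50 := pow_le_pow_left₀ h𝓛0.le hexp𝓛 50
      have h3 : Real.exp 𝓛 ^ 50 = Real.exp (50 * 𝓛) := by rw [← Real.exp_nat_mul]; norm_num
      rw [h1]
      refine h2.trans ?_
      rw [h3]
      exact Real.exp_le_exp.2 (by linarith)
    have huh : 1 ≤ u * h := by
      rw [hhdef]
      have : 𝓛 ^ 50 * (𝓛 ^ 50)⁻¹ = 1 := mul_inv_cancel₀ (by positivity)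
      calc (1 : ℝ) = 𝓛 ^ 50 * (𝓛 ^ 50)⁻¹ := this.symm
        _ ≤ u * (𝓛 ^ 50)⁻¹ := mul_le_mul_of_nonneg_right hubig (by positivity)
    have hstep : u ≤ Y' * h := by
      calc u = u * 1 * 1 * 1 := by ring
        _ ≤ u * u * u * (u * h) := by gcongr
        _ = u ^ 4 * h := by ring
        _ = Y' * h := by rw [hu4]
    have hexp1 : h + 1 ≤ Real.exp h := Real.add_one_le_exp h
    calc Y' + u ≤ Y' + Y' * h := by linarith
      _ = Y' * (h + 1) := by ring
      _ ≤ Y' * Real.exp h := mul_le_mul_of_nonneg_left hexp1 hY'0.le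
      _ = Y := hYeq.symm
  -- the core estimate (μ = 6)
  have hcore := logfree_core χ c' hχ1 hp h𝓛3 hA' j 6 hd0 hr0 (y := Y) (y' := Y') hTY' hY'Y.le
    hlog1 U (ρ := ρ) (η := η) (MU := MU) (BL := 2 * (4 + 3 * 𝓛)) (Minv := 3 * Cinv * 𝓛)
    (C₈₃ := C) (K := K₈) (ℓ₀ := ℓ₀) hUd hU1 hMU0 hU hC0 hU3' hαη hη40 (by positivity) hBL
    (by positivity) hpk hρ1 hρη hρα hLρ hL'ρ hℓ₀0 hℓ' le_rfl hK₈L hE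
  set hatPi : ℝ := ∏ q ∈ (d * r).primeFactors, (1 - (q : ℝ)⁻¹)⁻¹ with hhatPi
  have hPi : 1 ≤ hatPi :=
    Literature.NumberTheory.Sieve.GreenTao2008.GYCorr.one_le_prod_one_sub_inv_inv (d * r)
  have hbook := rhs_logfree_le (𝓛 := 𝓛) (Ly := Real.log Y) (Ly' := Real.log Y')
    (h := Real.log Y - Real.log Y') (c := c) (Cinv := Cinv) (C := C) (K := K₈) (A₁ := A₁)
    (hatPi := hatPi) (MU := MU) (α := alpha D) (η := η) (T := (D : ℝ)) (BL := 2 * (4 + 3 * 𝓛))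
    (Minv := 3 * Cinv * 𝓛) (m := m) h𝓛3 hc hc4 hCinv hC0 hK₈1 hA₁0 hMU0 hMUle hPi hlogY0 hlogY2
    hlogY'1 hαeq rfl hDexp rfl rfl hlogh
  have hlhpos : 0 < Real.log Y - Real.log Y' := by rw [hlogh]; positivity
  have hmain : ‖(∑ n ∈ Finset.Ioc 0 ⌊Y⌋₊,
          (χ (n : ZMod D) * xiZero c' D j n d r * (n : ℂ) ^ (betaMu D 6 - 1)) *
            (Real.log (Y / n) : ℂ)) -
        ∑ n ∈ Finset.Ioc 0 ⌊Y'⌋₊,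
          (χ (n : ZMod D) * xiZero c' D j n d r * (n : ℂ) ^ (betaMu D 6 - 1)) *
            (Real.log (Y' / n) : ℂ)‖ / (Real.log Y - Real.log Y') ≤
      Cbook * (𝓛 ^ 4)⁻¹ * hatPi ^ 4 := by
    refine (div_le_div_of_nonneg_right hcore hlhpos.le).trans ?_
    rw [hCbook]
    exact hbook
  -- the window
  have hwin' := hwin c' D χ j 6 d r Y Y' hx₀Y' hYY'4 hY2
  have hquot : (Y - Y') / Y' ≤ 2 * h := by
    have e : (Y - Y') / Y' = Real.exp h - 1 := by
      rw [hYeq]; field_simp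
    rw [e]
    have habs := Real.abs_exp_sub_one_le (x := h) (by rw [abs_of_pos hh0]; linarith)
    rw [abs_of_pos hh0] at habs
    exact le_trans (le_abs_self _) habs
  have hwin2 : ∑ n ∈ Finset.Ioc ⌊Y'⌋₊ ⌊Y⌋₊,
      ‖χ (n : ZMod D) * xiZero c' D j n d r * (n : ℂ) ^ (betaMu D 6 - 1)‖ ≤
      2 * Cw * (𝓛 ^ 4)⁻¹ * hatPi ^ 4 := by
    refine hwin'.trans ?_
    have h36 : Real.log Y' ^ 4 ≤ (𝓛 ^ 9) ^ 4 := pow_le_pow_left₀ hlogY'0 hlogY'le 4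
    have hPi4 : 1 ≤ hatPi ^ 4 := one_le_pow₀ hPi
    calc Cw * ((Y - Y') / Y') * Real.log Y' ^ 4 ≤ Cw * (2 * h) * (𝓛 ^ 9) ^ 4 := by
          gcongr
      _ = 2 * Cw * ((𝓛 ^ 4)⁻¹ * (𝓛 ^ 10)⁻¹) := by rw [hhdef]; field_simp
      _ ≤ 2 * Cw * ((𝓛 ^ 4)⁻¹ * 1) := by
          gcongr
          exact inv_le_one_of_one_le₀ (one_le_pow₀ h𝓛1)
      _ = 2 * Cw * (𝓛 ^ 4)⁻¹ * 1 := by ring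
      _ ≤ 2 * Cw * (𝓛 ^ 4)⁻¹ * hatPi ^ 4 := by gcongr
  -- the sharp sum from the two Riesz means
  have hR := norm_sum_Ico_le_of_riesz
    (fun n : ℕ => χ (n : ZMod D) * xiZero c' D j n d r * (n : ℂ) ^ (betaMu D 6 - 1)) hY'1 hY'Y
  beta_reduce at hR
  -- the summand of LF is the coefficient `f`
  have hβ6 : betaMu D 6 = beta6 D := by simp [betaMu]
  have hsumeq : (∑ l ∈ Finset.Ico 1 ⌈Y⌉₊,
      χ (l : ZMod D) * xiZero c' D j l d r / (l : ℂ) ^ (1 - beta6 D)) =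
      ∑ l ∈ Finset.Ico 1 ⌈Y⌉₊,
        χ (l : ZMod D) * xiZero c' D j l d r * (l : ℂ) ^ (betaMu D 6 - 1) := by
    refine Finset.sum_congr rfl fun l _ => ?_
    rw [div_eq_mul_inv, ← Complex.cpow_neg, neg_sub, hβ6]
  rw [hsumeq]
  -- assemble
  have hfinal : ‖∑ l ∈ Finset.Ico 1 ⌈Y⌉₊,
      χ (l : ZMod D) * xiZero c' D j l d r * (l : ℂ) ^ (betaMu D 6 - 1)‖ ≤
      (Cbook + 4 * Cw) * (𝓛 ^ 4)⁻¹ * hatPi ^ 4 := by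
    refine hR.trans ?_
    have := add_le_add hmain (mul_le_mul_of_nonneg_left hwin2 (by norm_num : (0 : ℝ) ≤ 2))
    refine this.trans (le_of_eq ?_)
    ring
  refine hfinal.trans (le_of_eq ?_)
  rw [hhatPi, prodInv_eq_self_div_totient hdr0, hℓ]

end Literature.NumberTheory.LFunctions.Zhang2022.Lemma84

namespace Literature.NumberTheory.LFunctions.Zhang2022.Typed.Sec12C

open Skeleton

/-- **The leaf `Mid1225` HOLDS** (for the manuscript's parameter range `c′ ≥ 0`): "the sum over
`P″₁/T < dr ≤ P″₁` contributes `o(α)`" (§12 p.71, tex L3605) — by the tree's reduction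
`mid1225_of_logfree` (Lemma 8.2 for the `m`-sum, Lemma 8.4ᴿ + the tail mean for the log part of the
`n`-sum; zl-w12-p1) and the log-free bound `Lemma84.logfree_mid_bound`. Closes the hypothesis `hMid`
of `Skeleton.theorem1_of_leaves_v19`. [cite: Zhang2022LandauSiegel, §12 (12.12) p.71, tex L3605] -/
theorem mid1225_holds (c' : ℝ) (hc' : 0 ≤ c') : Mid1225 c' :=
  mid1225_of_logfree c' hc' (Lemma84.logfree_mid_bound c')

end Literature.NumberTheory.LFunctions.Zhang2022.Typed.Sec12C
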